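import Mathlib
import Summits.Ventures.PercRepro2.CrossAPrimeA1V
import Summits.Ventures.PercRepro2.OneEdge
import Summits.Ventures.PercRepro2.RBRootEdge
import Summits.Ventures.PercRepro2.SameClusterAvoid
import Summits.Ventures.PercRepro2.BHKOutside

/-!
# The `a₁–v` edge: the dictionary `p[e ↦ 1] ↔ p[e ↦ 0]` and BHK 1.4 under the double avoidance
(blind cell PercRepro2, p5 g32; `proofs/P5-OEDGE.md` §42 (8), S4 §2.4 (s) addendum 19)

For an edge `e = {a₁, v}`: a `Q`-mass of an `a₂`-event with `e` pinned open is the mass of the same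
event with `e` pinned closed under the avoidance of `{a₁, v}` (**`prob_update_one_Q_inter`**; opening
`e` merges `v` into `C(a₁)`: `OneEdge.conn_update_true_iff`), and the functional BHK inequality
under the avoidance of `{a₁, v}` with the increasing functional `1 − g_v` gives
**`bhk_vL_avoid_pair`**: `P(Q,vL,oH)·P(a₂ ↮ {a₁,v}) ≤ P(oH, a₂ ↮ {a₁,v})·P(Q,vL)`
(`bhk_univ_avoid` + the tower identities of `BHKOutside`).  Both serve the middle Bernstein
coefficient of the `a₁–v` edge (`CrossAPrimeA1VMid`).  Own work; standard axioms.
-/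

namespace Summit.Ventures.PercRepro2

open LeafRowPendantRootSO CrossAPrimeA1V

namespace CrossAPrimeA1VDict

section Dictionary

variable {V : Type*} {E : Type*} [Fintype E] [DecidableEq E] [DecidableEq V] {R : Type*} [CommRing R]
variable {ends : E → Sym2 V} {e : E} {a₁ v : V}

omit [Fintype E] [DecidableEq V] in
/-- Under `a₂ ↮ a₁, v`, opening `e = {a₁, v}` does not change the connections of `a₂`. -/
lemma conn_update_true_a₂_iff (he : ends e = s(a₁, v)) (ω : Config E) {a₂ : V}
    (h1 : ¬ Conn ends ω a₂ a₁) (hv : ¬ Conn ends ω a₂ v) (w : V) :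
    Conn ends (Function.update ω e true) a₂ w ↔ Conn ends ω a₂ w := by
  rw [OneEdge.conn_update_true_iff he]
  constructor
  · rintro (h | ⟨h, _⟩ | ⟨h, _⟩)
    · exact h
    · exact absurd h h1
    · exact absurd h hv
  · exact fun h => Or.inl h

omit [Fintype E] in
/-- The configurations whose `e`-opening lies in `Q ∩ X` are those avoiding `{a₁, v}` and in `X`,
for an `a₂`-event `X` (one insensitive to opening `e` under the double avoidance). -/
lemma preimage_Q_inter (he : ends e = s(a₁, v)) {a₂ : V} {X : Set (Config E)}
    (hX : ∀ ω : Config E, ¬ Conn ends ω a₂ a₁ → ¬ Conn ends ω a₂ v →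
      (Function.update ω e true ∈ X ↔ ω ∈ X)) :
    {ω : Config E | Function.update ω e true ∈ avoidAll ends a₂ {a₁} ∩ X} =
      avoidAll ends a₂ {a₁, v} ∩ X := by
  ext ω
  simp only [Set.mem_setOf_eq, Set.mem_inter_iff, mem_avoidAll, Finset.mem_singleton,
    Finset.mem_insert, forall_eq_or_imp, forall_eq]
  constructor
  · rintro ⟨hQ, hXω⟩
    have hle : ω ≤ Function.update ω e true := OneEdge.le_update_true ω e
    have h1 : ¬ Conn ends ω a₂ a₁ := fun h => hQ (conn_mono hle h)
    have hv : ¬ Conn ends ω a₂ v := fun h => hQ (conn_trans (conn_mono hle h)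
      (conn_of_openAdj ⟨e, by simp, by rw [he, Sym2.eq_swap]⟩))
    exact ⟨⟨h1, hv⟩, (hX ω h1 hv).1 hXω⟩
  · rintro ⟨⟨h1, hv⟩, hXω⟩
    refine ⟨?_, (hX ω h1 hv).2 hXω⟩
    rw [OneEdge.conn_update_true_iff he]
    rintro (h | ⟨h, _⟩ | ⟨h, _⟩)
    · exact h1 h
    · exact h1 h
    · exact hv h

omit [DecidableEq V] in
/-- A set whose membership is decided by the `e`-opening has the same mass at `p`, `p[e ↦ 0]` and
`p[e ↦ 1]`. -/
lemma prob_update_zero_preimage (p : E → R) (S : Set (Config E)) :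
    prob (Function.update p e 0) {ω : Config E | Function.update ω e true ∈ S} =
      prob p {ω : Config E | Function.update ω e true ∈ S} := by
  rw [RBRootEdge.prob_update_zero_eq]
  congr 1
  ext ω
  simp only [Set.mem_setOf_eq]
  rw [Function.update_idem]

/-- **The dictionary**: a `Q`-mass with `e = {a₁, v}` pinned open is the mass, with `e` pinned
closed, of the same `a₂`-event under the avoidance of `{a₁, v}`. -/
theorem prob_update_one_Q_inter (p : E → R) (he : ends e = s(a₁, v)) {a₂ : V} {X : Set (Config E)}
    (hX : ∀ ω : Config E, ¬ Conn ends ω a₂ a₁ → ¬ Conn ends ω a₂ v →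
      (Function.update ω e true ∈ X ↔ ω ∈ X)) :
    prob (Function.update p e 1) (avoidAll ends a₂ {a₁} ∩ X) =
      prob (Function.update p e 0) (avoidAll ends a₂ {a₁, v} ∩ X) := by
  rw [RBRootEdge.prob_update_one_eq, ← prob_update_zero_preimage p, preimage_Q_inter he hX]

omit [Fintype E] [DecidableEq V] in
/-- `a₂`-connection events are insensitive. -/
lemma hX_conn (he : ends e = s(a₁, v)) (a₂ w : V) :
    ∀ ω : Config E, ¬ Conn ends ω a₂ a₁ → ¬ Conn ends ω a₂ v →
      (Function.update ω e true ∈ connEvent ends a₂ w ↔ ω ∈ connEvent ends a₂ w) :=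
  fun ω h1 hv => conn_update_true_a₂_iff he ω h1 hv w

omit [Fintype E] [DecidableEq V] in
/-- Intersections of insensitive events are insensitive. -/
lemma hX_inter {a₂ : V} {X Y : Set (Config E)}
    (hX : ∀ ω : Config E, ¬ Conn ends ω a₂ a₁ → ¬ Conn ends ω a₂ v →
      (Function.update ω e true ∈ X ↔ ω ∈ X))
    (hY : ∀ ω : Config E, ¬ Conn ends ω a₂ a₁ → ¬ Conn ends ω a₂ v →
      (Function.update ω e true ∈ Y ↔ ω ∈ Y)) :
    ∀ ω : Config E, ¬ Conn ends ω a₂ a₁ → ¬ Conn ends ω a₂ v →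
      (Function.update ω e true ∈ X ∩ Y ↔ ω ∈ X ∩ Y) := fun ω h1 hv => by
  simp only [Set.mem_inter_iff, hX ω h1 hv, hY ω h1 hv]

omit [Fintype E] [DecidableEq V] in
/-- `univ` is insensitive. -/
lemma hX_univ {a₂ : V} :
    ∀ ω : Config E, ¬ Conn ends ω a₂ a₁ → ¬ Conn ends ω a₂ v →
      (Function.update ω e true ∈ (Set.univ : Set (Config E)) ↔ ω ∈ Set.univ) :=
  fun _ _ _ => by simp

end Dictionary


section Bounds

variable {V : Type*} {E : Type*} [Fintype E] [DecidableEq E] [Fintype V] [DecidableEq V]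
  {R : Type*} [Field R] [LinearOrder R] [IsStrictOrderedRing R]
variable {ends : E → Sym2 V} {e : E} {a₁ v : V}

omit [Fintype V] [LinearOrder R] [IsStrictOrderedRing R] in
/-- The outside probability of `a₁` vanishes on `a₁`-containing clusters, so the avoidance of
`{a₁, v}` can be relaxed to that of `{v}` under it. -/
lemma outside_mul_avoid_insert (p : E → R) (a₂ : V) (𝓥 : Set (Set V)) (ω : Config E) :
    outsideProb p ends a₁ 𝓥 (cluster ends ω a₂) * (avoidAll ends a₂ {a₁, v}).indicator 1 ω =
      outsideProb p ends a₁ 𝓥 (cluster ends ω a₂) * (avoidAll ends a₂ {v}).indicator 1 ω := by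
  by_cases h1 : a₁ ∈ cluster ends ω a₂
  · rw [outsideProb_apply_of_mem p 𝓥 h1, zero_mul, zero_mul]
  · have : ω ∈ avoidAll ends a₂ {a₁, v} ↔ ω ∈ avoidAll ends a₂ {v} := by
      rw [mem_avoidAll_insert_iff]
      exact ⟨fun h => h.2, fun h => ⟨h1, h⟩⟩
    by_cases hω : ω ∈ avoidAll ends a₂ {v}
    · rw [Set.indicator_of_mem hω, Set.indicator_of_mem (this.2 hω)]
    · rw [Set.indicator_of_notMem hω, Set.indicator_of_notMem (fun h => hω (this.1 h))]

omit [Fintype E] [DecidableEq E] [Fintype V] in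
/-- `{v ∈ C(a₁)} ∩ {a₂ ↮ a₁}` already avoids `v`. -/
lemma Q_inter_vL_eq (a₂ o : V) :
    avoidAll ends a₂ {a₁} ∩ (connEvent ends a₁ v ∩ connEvent ends a₂ o) =
      connEvent ends a₂ o ∩ connEvent ends a₁ v ∩ avoidAll ends a₂ {a₁, v} := by
  ext ω
  simp only [Set.mem_inter_iff, mem_avoidAll, Finset.mem_singleton, Finset.mem_insert,
    forall_eq_or_imp, forall_eq, connEvent, Set.mem_setOf_eq]
  constructor
  · rintro ⟨h1, hv, ho⟩
    exact ⟨⟨ho, hv⟩, h1, fun h => h1 (conn_trans h (conn_symm hv))⟩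
  · rintro ⟨⟨ho, hv⟩, h1, _⟩
    exact ⟨h1, hv, ho⟩

omit [Fintype E] [DecidableEq E] [Fintype V] in
/-- `{v ∈ C(a₁)} ∩ {a₂ ↮ a₁}` already avoids `v` (no `o`). -/
lemma Q_inter_vL_eq' (a₂ : V) :
    avoidAll ends a₂ {a₁} ∩ connEvent ends a₁ v =
      connEvent ends a₁ v ∩ avoidAll ends a₂ {a₁, v} := by
  ext ω
  simp only [Set.mem_inter_iff, mem_avoidAll, Finset.mem_singleton, Finset.mem_insert,
    forall_eq_or_imp, forall_eq, connEvent, Set.mem_setOf_eq]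
  constructor
  · rintro ⟨h1, hv⟩
    exact ⟨hv, h1, fun h => h1 (conn_trans h (conn_symm hv))⟩
  · rintro ⟨hv, h1, _⟩
    exact ⟨h1, hv⟩

/-- **BHK 1.4 under the avoidance of `{a₁, v}`**: `P(Q,vL,oH) · P(a₂ ↮ {a₁,v}) ≤ P(oH, a₂ ↮ {a₁,v}) · P(Q,vL)`. -/
theorem bhk_vL_avoid_pair (p : E → R) (hp : IsProbVec p) (a₂ o : V) :
    prob p (avoidAll ends a₂ {a₁} ∩ (connEvent ends a₁ v ∩ connEvent ends a₂ o)) *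
        prob p (avoidAll ends a₂ {a₁, v}) ≤
      prob p (avoidAll ends a₂ {a₁, v} ∩ connEvent ends a₂ o) *
        prob p (avoidAll ends a₂ {a₁} ∩ connEvent ends a₁ v) := by
  classical
  set 𝓤 : Set (Set V) := {W | o ∈ W} with h𝓤
  set 𝓥 : Set (Set V) := {W | v ∈ W} with h𝓥
  have hU : IsUpperSet 𝓤 := fun _ _ hWW' ho => hWW' ho
  have hV : IsUpperSet 𝓥 := fun _ _ hWW' hv => hWW' hv
  have hF₁ : Monotone (𝓤.indicator (1 : Set V → R)) := monotone_indicator_one_of_isUpperSet hU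
  have hF₂ : Monotone (fun W => 1 - outsideProb p ends a₁ 𝓥 W) := fun W W' h => by
    have := outsideProb_anti hp ends a₁ hV h
    simp only
    linarith
  have hF₁0 : ∀ W, 0 ≤ 𝓤.indicator (1 : Set V → R) W :=
    fun W => Set.indicator_apply_nonneg fun _ => zero_le_one
  have hF₂0 : ∀ W, 0 ≤ 1 - outsideProb p ends a₁ 𝓥 W :=
    fun W => sub_nonneg.2 (outsideProb_le_one hp ends a₁ 𝓥 W)
  have key := bhk_univ_avoid p hp ends a₂ {a₁, v} hF₁ hF₂ hF₁0 hF₂0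
  -- the four expectations
  have e1 : expect p (fun ω => 𝓤.indicator (1 : Set V → R) (cluster ends ω a₂) *
      (avoidAll ends a₂ {a₁, v}).indicator 1 ω) =
      prob p (avoidAll ends a₂ {a₁, v} ∩ connEvent ends a₂ o) := by
    rw [← prob_clusterInEvent_inter_eq_expect, Set.inter_comm, clusterInEvent_mem_eq]
  have eg : expect p (fun ω => outsideProb p ends a₁ 𝓥 (cluster ends ω a₂) *
      (avoidAll ends a₂ {a₁, v}).indicator 1 ω) =
      prob p (avoidAll ends a₂ {a₁} ∩ connEvent ends a₁ v) := by
    simp only [outside_mul_avoid_insert p a₂ 𝓥]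
    rw [← prob_outside_inter_avoid_eq_expect p ends a₂ a₁ {v} 𝓥, Q_inter_vL_eq', h𝓥,
      clusterInEvent_mem_eq]
  have eug : expect p (fun ω => 𝓤.indicator (1 : Set V → R) (cluster ends ω a₂) *
      outsideProb p ends a₁ 𝓥 (cluster ends ω a₂) * (avoidAll ends a₂ {a₁, v}).indicator 1 ω) =
      prob p (avoidAll ends a₂ {a₁} ∩ (connEvent ends a₁ v ∩ connEvent ends a₂ o)) := by
    have : (fun ω => 𝓤.indicator (1 : Set V → R) (cluster ends ω a₂) *
        outsideProb p ends a₁ 𝓥 (cluster ends ω a₂) * (avoidAll ends a₂ {a₁, v}).indicator 1 ω) =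
        fun ω => 𝓤.indicator (1 : Set V → R) (cluster ends ω a₂) *
        outsideProb p ends a₁ 𝓥 (cluster ends ω a₂) * (avoidAll ends a₂ {v}).indicator 1 ω := by
      funext ω
      rw [mul_assoc, outside_mul_avoid_insert p a₂ 𝓥, ← mul_assoc]
    rw [this, ← prob_clusterIn_outside_inter_avoid_eq_expect p ends a₂ a₁ {v} 𝓤 𝓥, Q_inter_vL_eq,
      h𝓤, h𝓥, clusterInEvent_mem_eq, clusterInEvent_mem_eq]
  have eZ : expect p (fun ω => (avoidAll ends a₂ {a₁, v}).indicator 1 ω) =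
      prob p (avoidAll ends a₂ {a₁, v}) := (prob_eq_expect_indicator p _).symm
  -- expand the functional inequality
  have l2 : expect p (fun ω => (1 - outsideProb p ends a₁ 𝓥 (cluster ends ω a₂)) *
      (avoidAll ends a₂ {a₁, v}).indicator 1 ω) =
      prob p (avoidAll ends a₂ {a₁, v}) - prob p (avoidAll ends a₂ {a₁} ∩ connEvent ends a₁ v) := by
    rw [← eZ, ← eg, ← expect_sub]
    unfold expect
    refine Finset.sum_congr rfl fun ω _ => ?_
    simp only [Pi.sub_apply]
    ring
  have l3 : expect p (fun ω => 𝓤.indicator (1 : Set V → R) (cluster ends ω a₂) *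
      (1 - outsideProb p ends a₁ 𝓥 (cluster ends ω a₂)) *
      (avoidAll ends a₂ {a₁, v}).indicator 1 ω) =
      prob p (avoidAll ends a₂ {a₁, v} ∩ connEvent ends a₂ o) -
        prob p (avoidAll ends a₂ {a₁} ∩ (connEvent ends a₁ v ∩ connEvent ends a₂ o)) := by
    rw [← e1, ← eug, ← expect_sub]
    unfold expect
    refine Finset.sum_congr rfl fun ω _ => ?_
    simp only [Pi.sub_apply]
    ring
  rw [e1, l2, l3] at key
  nlinarith [key]

end Bounds

end CrossAPrimeA1VDict

end Summit.Ventures.PercRepro2
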